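import Literature.AlgebraicGeometry.Resolution.RationalSurfaceSingularitiesBasic
import Literature.AlgebraicGeometry.Resolution.BirationalDimensionReduced
import Mathlib.AlgebraicGeometry.Fiber
import HarnessLib

/-!
# Fibres of a resolution of a surface singularity have dimension at most one

Topic: `Literature/AlgebraicGeometry/Resolution`. PROVED: for a Noetherian domain `T` of Krull
dimension `≤ 2` and a resolution of singularities `π : X → Spec T` (proper, birational, `X`
regular), every scheme-theoretic fibre `X_y = π.fiber y` has topological Krull dimension `≤ 1`.
This is the hypothesis "`f` is a proper map whose fibres have dimension `≤ 1`" of Lipman 1969,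
Theorem (12.1) (`Lipman1969_12_1_i`, `Lipman1969_12_1_ii` in
`Resolution/Lipman1969RationalSurfaceSingularities.lean`) in the case of interest there
(§12–§14: `f` a desingularization of a two-dimensional normal local ring), discharged once and
for all for the consumers of those named facts.

Proof: `dim X ≤ dim Spec T ≤ 2` (`IsResolution.topologicalKrullDim_le_of_isNoetherian`). The fibre
over the generic point `η` is the single point `ξ = ` generic point of `X` (`π` is an isomorphism
over a dense open `U ∋ η`, and `π(ξ) = η`). For `y ≠ η` the fibre lies in the closed set
`S = π⁻¹(closure {y})`, which misses `ξ`; a closed subset with dense complement of the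
Noetherian sober space `X` of dimension `< 3` has dimension `< 2`
(`topologicalKrullDim_lt_of_isClosed_of_dense_compl`).

## References

* J. Lipman, *Rational singularities …*, Publ. Math. IHÉS 36 (1969), §12, Theorem (12.1)
  (hypothesis on the fibres) and §14 (application to `f : X → Spec R`, `R` two-dimensional).
  [Lipman1969]
* A. Grothendieck, EGA IV₂, (5.6.5.1) (dimension inequality). [EGAIV2]
-/

noncomputable section

open CategoryTheory AlgebraicGeometry TopologicalSpace Topology

universe u

namespace Literature.AlgebraicGeometry.Resolution

/-- In `WithBot ℕ∞`: `d < 2 → d ≤ 1`. [folklore] -/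
private theorem withBotENat_le_one_of_lt_two {d : WithBot ℕ∞} (h : d < (2 : ℕ)) : d ≤ 1 := by
  induction d using WithBot.recBotCoe with
  | bot => exact bot_le
  | coe a =>
    induction a using ENat.recTopCoe with
    | top => exact absurd h (by simp)
    | coe n =>
      have h' : ((n : ℕ∞) : WithBot ℕ∞) < ((2 : ℕ∞) : WithBot ℕ∞) := by simpa using h
      have h2 : (n : ℕ∞) < 2 := WithBot.coe_lt_coe.mp h'
      have h3 : n < 2 := by exact_mod_cast h2
      exact_mod_cast (show n ≤ 1 by omega)

/-- **The generic fibre of a birational morphism to an integral scheme is one point**: if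
`π : X → Y` is birational (an isomorphism over a dense open `U`) with `X` and `Y` irreducible,
every point of `X` over the generic point of `Y` is the generic point of `X`.
[cite: StacksProject, Tag 01RN] -/
theorem IsBirational.eq_genericPoint_of_apply_eq {X Y : Scheme.{u}} [IrreducibleSpace X]
    [IrreducibleSpace Y] {π : X ⟶ Y} (hπ : IsBirational π) {x : X}
    (hx : π x = genericPoint Y) : x = genericPoint X := by
  haveI : IsDominant π := hπ.isDominant
  have hξ : π (genericPoint X) = genericPoint Y := Motives.RatFn.genericPoint_eq_of_isDominant π
  obtain ⟨U, hU, -, hiso⟩ := hπ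
  have hηU : genericPoint Y ∈ U :=
    ((genericPoint_spec Y).mem_open_set_iff U.isOpen).mpr (by rw [Set.univ_inter]; exact hU.nonempty)
  have hxU : x ∈ π ⁻¹ᵁ U := show π x ∈ U by rw [hx]; exact hηU
  have hξU : genericPoint X ∈ π ⁻¹ᵁ U := show π (genericPoint X) ∈ U by rw [hξ]; exact hηU
  have hinj := (Scheme.homeoOfIso (asIso (π ∣_ U))).injective
  have key : (π ∣_ U) ⟨x, hxU⟩ = (π ∣_ U) ⟨genericPoint X, hξU⟩ := by
    apply Subtype.ext
    rw [morphismRestrict_base_coe, morphismRestrict_base_coe]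
    exact hx.trans hξ.symm
  exact congrArg Subtype.val (hinj key)

/-- **Fibres of a resolution of a surface singularity have dimension `≤ 1`**: for `T` a
Noetherian domain of Krull dimension `≤ 2` and `π : X → Spec T` a resolution of singularities,
every scheme-theoretic fibre `π.fiber y` (Mathlib `Scheme.Hom.fiber`) has topological Krull
dimension `≤ 1` — the fibre hypothesis of Lipman's Theorem (12.1) for the desingularizations of
two-dimensional local rings to which it is applied (Lipman 1969, §14).
[cite: Lipman1969, Theorem (12.1) hypothesis and Section 14] -/
theorem IsResolution.topologicalKrullDim_fiber_le_one {T : Type u} [CommRing T]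
    [IsNoetherianRing T] [IsDomain T] (hdim : ringKrullDim T ≤ 2) {X : Scheme.{u}}
    {π : X ⟶ Spec (.of T)} (hπ : IsResolution π) (y : Spec (.of T)) :
    topologicalKrullDim (π.fiber y) ≤ 1 := by
  haveI : IsProper π := hπ.isProper
  haveI : IsIntegral X := hπ.isIntegral_source
  haveI : IsNoetherian X := by
    haveI : IsLocallyNoetherian X := LocallyOfFiniteType.isLocallyNoetherian π
    haveI : CompactSpace X := QuasiCompact.compactSpace_of_compactSpace π
    exact {}
  haveI : IsDominant π := hπ.isBirational.isDominant
  have hX : topologicalKrullDim X ≤ 2 := by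
    refine hπ.topologicalKrullDim_le_of_isNoetherian.trans ?_
    change topologicalKrullDim (PrimeSpectrum T) ≤ 2
    rw [PrimeSpectrum.topologicalKrullDim_eq_ringKrullDim]
    exact hdim
  rw [IsHomeomorph.topologicalKrullDim_eq _ (π.fiberHomeo y).isHomeomorph]
  have hξ : π (genericPoint X) = genericPoint (Spec (.of T)) :=
    Motives.RatFn.genericPoint_eq_of_isDominant π
  by_cases hy : y = genericPoint (Spec (.of T))
  · -- the generic fibre is the single point `ξ`
    subst hy
    haveI : Subsingleton (π ⁻¹' {genericPoint (Spec (.of T))} : Set X) :=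
      ⟨fun a b => Subtype.ext
        ((hπ.isBirational.eq_genericPoint_of_apply_eq a.2).trans
          (hπ.isBirational.eq_genericPoint_of_apply_eq b.2).symm)⟩
    exact (topologicalKrullDim_zero_of_discreteTopology _).trans zero_le_one
  · -- the other fibres lie in a proper closed subset
    set S : Set X := π ⁻¹' closure {y} with hS_def
    have hS : IsClosed S := isClosed_closure.preimage π.continuous
    have hξS : genericPoint X ∉ S := by
      intro h
      have h1 : π (genericPoint X) ∈ closure {y} := h
      rw [hξ, ← specializes_iff_mem_closure] at h1
      exact hy (h1.antisymm (genericPoint_specializes y)).eq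
    have hSd : Dense Sᶜ := hS.isOpen_compl.dense ⟨genericPoint X, hξS⟩
    have hX' : topologicalKrullDim X < (2 + 1 : ℕ) :=
      lt_of_le_of_lt hX (by exact_mod_cast (show (2 : ℕ) < 2 + 1 by norm_num))
    have hlt : topologicalKrullDim S < (2 : ℕ) :=
      topologicalKrullDim_lt_of_isClosed_of_dense_compl hS hSd 2 hX'
    have hsub : π ⁻¹' {y} ⊆ S := fun x hx => subset_closure hx
    have hF : topologicalKrullDim (π ⁻¹' {y} : Set X) ≤ topologicalKrullDim S :=
      (IsEmbedding.inclusion hsub).isInducing.topologicalKrullDim_le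
    exact hF.trans (withBotENat_le_one_of_lt_two hlt)

/-- **Fibres of a proper birational morphism onto a surface germ have dimension `≤ 1`** — the same
statement WITHOUT regularity of the source (used for the middle space of a composite modification,
e.g. a blowing-up `Bl_I(Spec T) → Spec T` dominated by a resolution): for `T` a Noetherian domain of
Krull dimension `≤ 2` and `π : X → Spec T` proper and birational with `X` integral, every
scheme-theoretic fibre `π.fiber y` has topological Krull dimension `≤ 1`.  Same proof as
`IsResolution.topologicalKrullDim_fiber_le_one` (`dim X ≤ 2` by
`IsBirational.topologicalKrullDim_le_of_isNoetherian`; the generic fibre is the generic point; the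
other fibres lie in a closed nowhere dense subset). [cite: Lipman1969, §12 Theorem (12.1) (hypothesis
on the fibres), §14] [cite: EGAIV2, 5.6.5.1] -/
theorem topologicalKrullDim_fiber_le_one_of_isBirational {T : Type u} [CommRing T]
    [IsNoetherianRing T] [IsDomain T] (hdim : ringKrullDim T ≤ 2) {X : Scheme.{u}} [IsIntegral X]
    {π : X ⟶ Spec (.of T)} [IsProper π] (hπ : IsBirational π) (y : Spec (.of T)) :
    topologicalKrullDim (π.fiber y) ≤ 1 := by
  haveI : IsNoetherian X := by
    haveI : IsLocallyNoetherian X := LocallyOfFiniteType.isLocallyNoetherian π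
    haveI : CompactSpace X := QuasiCompact.compactSpace_of_compactSpace π
    exact {}
  haveI : IsDominant π := hπ.isDominant
  have hX : topologicalKrullDim X ≤ 2 := by
    refine hπ.topologicalKrullDim_le_of_isNoetherian.trans ?_
    change topologicalKrullDim (PrimeSpectrum T) ≤ 2
    rw [PrimeSpectrum.topologicalKrullDim_eq_ringKrullDim]
    exact hdim
  rw [IsHomeomorph.topologicalKrullDim_eq _ (π.fiberHomeo y).isHomeomorph]
  have hξ : π (genericPoint X) = genericPoint (Spec (.of T)) :=
    Motives.RatFn.genericPoint_eq_of_isDominant π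
  by_cases hy : y = genericPoint (Spec (.of T))
  · -- the generic fibre is the single point `ξ`
    subst hy
    haveI : Subsingleton (π ⁻¹' {genericPoint (Spec (.of T))} : Set X) :=
      ⟨fun a b => Subtype.ext
        ((hπ.eq_genericPoint_of_apply_eq a.2).trans (hπ.eq_genericPoint_of_apply_eq b.2).symm)⟩
    exact (topologicalKrullDim_zero_of_discreteTopology _).trans zero_le_one
  · -- the other fibres lie in a proper closed subset
    set S : Set X := π ⁻¹' closure {y} with hS_def
    have hS : IsClosed S := isClosed_closure.preimage π.continuous
    have hξS : genericPoint X ∉ S := by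
      intro h
      have h1 : π (genericPoint X) ∈ closure {y} := h
      rw [hξ, ← specializes_iff_mem_closure] at h1
      exact hy (h1.antisymm (genericPoint_specializes y)).eq
    have hSd : Dense Sᶜ := hS.isOpen_compl.dense ⟨genericPoint X, hξS⟩
    have hX' : topologicalKrullDim X < (2 + 1 : ℕ) :=
      lt_of_le_of_lt hX (by exact_mod_cast (show (2 : ℕ) < 2 + 1 by norm_num))
    have hlt : topologicalKrullDim S < (2 : ℕ) :=
      topologicalKrullDim_lt_of_isClosed_of_dense_compl hS hSd 2 hX'
    have hsub : π ⁻¹' {y} ⊆ S := fun x hx => subset_closure hx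
    have hF : topologicalKrullDim (π ⁻¹' {y} : Set X) ≤ topologicalKrullDim S :=
      (IsEmbedding.inclusion hsub).isInducing.topologicalKrullDim_le
    exact hF.trans (withBotENat_le_one_of_lt_two hlt)

end Literature.AlgebraicGeometry.Resolution

end
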